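import Literature.NumberTheory.GaloisCohomology.Howard2004.TowerSelmerLiftPairingWellDefinedProofs
import Literature.NumberTheory.GaloisCohomology.Howard2004.DVRSettingLevelConditionsCocartesianProofs
import Literature.NumberTheory.GaloisCohomology.Howard2004.DVRSettingLevelConditionsCartesianProofs
import HarnessLib

/-!
# Howard 2004, Prop. 1.4.1 on a `DVRSetting`, CLASS-LEVEL: the Cassels–Tate / Flach pairing of the level sequence
# `0 → N_0 →ι T^{(t+1)} →red T^{(i)} → 0` DEFINED by the Poitou–Tate value on local defects (brick «C451-CL Q2 = CTP-DEF»)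

Topic `NumberTheory/GaloisCohomology/Howard2004` (cell `pub/bsd-print-x9`; the class-level kernel port «C451-CL» of the Flach leaf
C45.1″ `prop141_casselsTate_skewPairing_atLevel_printIntended`, LEAD `bsd-line-x10b-p1` g14 plan 2026-08-29; seat
`bsd-line-x10b-p1-w2` g18).  THEOREMS ONLY: no definition, no named fact, no instance, no notation, no `sorry`.

SOURCE.  B. Howard, *The Heegner point Kolyvagin system*, Compositio Math. **140** (2004) = arXiv:1202.6340, §1.4 (p. 8 L38–81:
the recipe `(a,b)_{s,t} = Σ_v inv_v(α_v ∪ β'_v − ε_v)`, «it can be checked that this is independent of all choices made»),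
Prop. 1.4.1 (p. 8 L83–98).  M. Flach, *A generalisation of the Cassels–Tate pairing*, J. reine angew. Math. **412** (1990);
A. Morgan–A. Smith, arXiv:2103.08530, Def. 3.2 / Prop. 3.3.  ON A `DVRSetting` WITH H.0–H.5 EVERY `𝓕(n)`-Selmer class of
`T^{(i)}` LIFTS to a global class of `H¹(K, T^{(t+1)})` (`Ш²(K, N_0) = 0`: `ResidualShaOneVanishingProofs`,
`ResidualShaTwoVanishingProofs`, `TowerSelmerShaTwoObstructionProofs`; here the hypothesis `hlift`), so in Howard's recipe the
cochain `α` may be taken to be a COCYCLE: `f = 0`, `ε = 0`, and `α_v − α'_v = ι(m_v)` with `m_v ∈ H¹(K_v, N_0)` the LOCAL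
DEFECTS of the lift (`TowerSelmerLiftGlobalDualityProofs` §4) — the value is the Poitou–Tate sum
`Σ_{v ∈ Σ} inv_v(m_v ∪ loc_v y)` (`localTatePairingZMod`), a function of classes only.

* **`DVRSetting.exists_towerCasselsTatePairing`** — for a `DVRSetting` `S` with H.0–H.5, `p ∤ #𝓞_K^×`, levels `i ≤ t+1`,
  `n ⊆ 𝓛^{(t+1)}`, a presentation `ι : N_0 ↪ T^{(t+1)}` of `ker red` cartesian for `𝓕(n)` (`hιF`), a family `inv` of local
  invariants at a level `n₀` killing `N_0` with the reciprocity law, and global lifts (`hlift`): THERE IS a bi-additive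
  `P : H¹_{𝓕(n)}(K, T^{(i)}) × H¹_{𝓕(n)_0^*}(K, N_0^∨(1)) → ℤ/n₀` such that for EVERY lift `ã` of `a`, EVERY family of local defects
  `m` of `ã` supported on ANY finite `Σ`, and every `y`: `P a y = Σ_{v ∈ Σ} inv_v(m_v ∪ loc_v y)`.
  Existence of SOME admissible `(ã, m, Σ)` for each `a`: `hlift` + the local Selmer lifts (`DVRSettingLevelConditionsCocartesianProofs`,
  under `hu`) + the finite exceptional set of `ã` (`DVRSettingLevelConditionsCartesianProofs` §4) +
  `exists_localDefects_of_forall_exists_redLELoc_eq`; independence of the choice: x10b-p1-w8's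
  `sum_localTatePairingZMod_defects_eq`; additivity in `a`: `localDefects_add`; additivity in `y`: termwise.
* `DVRSetting.towerCasselsTatePairing_eq_zero_of_exists_selmer_lift` — the EASY half of the left kernel: `P (red z) = 0` for
  `z ∈ H¹_{𝓕(n)}(K, T^{(t+1)})` (lift `ã := z`, defects `m = 0`).
* **`DVRSetting.forall_towerCasselsTatePairing_eq_zero_iff`** (C451-CL Q3 = Prop. 1.4.1's LEFT kernel, class-level):
  `(∀ y, P a y = 0) ↔ ∃ z ∈ H¹_{𝓕(n)}(K, T^{(t+1)}), red z = a` — x10b-p1-w8's Poitou–Tate criterion (LIFT-PT) composed with the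
  value clause, its side conditions discharged by the letters of `DVRSettingLevelConditionsCartesianProofs` §4.

HONEST FRAMING.  This is the DEFINITION step (Q2) and the LEFT kernel (Q3) of the class-level port; the right kernel (Q5), the
dual-slot identification (Q4), the skew-symmetry (Q6) and the assembly (Q7) are separate bricks; Prop. 1.4.1, C45.1″ and `thm161_dvrKolyvaginBound` are NOT
proved here; no summit statement is proved; BSD is not proved by any of this.

References: [Howard2004HeegnerKolyvagin] §1.4 and Prop. 1.4.1 (arXiv:1202.6340 p. 8 L38–98); [Flach1990] (the pairing and the
independence of choices); [MilneADT2006] I §4, I Thm. 4.10 (Poitou–Tate), I §6 Prop. 6.9 (the recipe for elliptic curves).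
-/

set_option autoImplicit false

noncomputable section

namespace Literature.NumberTheory.GaloisCohomology.Howard2004

open Function NumberField IsDedekindDomain Field CategoryTheory
open scoped NumberField ContRepresentation
open Literature.NumberTheory.GaloisRepresentations
open Literature.NumberTheory.GaloisRepresentations.DiscreteGaloisModule
open Literature.NumberTheory.GaloisCohomology (LocalInvariants)

namespace DVRSetting

variable {p : ℕ} [Fact p.Prime] {K : Type} [Field K] [NumberField K]
  {R : Type} [CommRing R] [IsDomain R] [IsDiscreteValuationRing R] [Algebra ℤ_[p] R]
  {N : ℕ → Type} [∀ k, AddCommGroup (N k)] [∀ k, TopologicalSpace (N k)]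
  [∀ k, DiscreteTopology (N k)] [∀ k, Module R (N k)]
  {Rk : ℕ → Type} [∀ k, CommRing (Rk k)] [∀ k, IsLocalRing (Rk k)] [∀ k, TopologicalSpace (Rk k)]
  [∀ k, DiscreteTopology (Rk k)] [∀ k, Algebra ℤ_[p] (Rk k)] [∀ k, Algebra R (Rk k)]
  [∀ k, Module (Rk k) (N k)] [∀ k, IsScalarTower R (Rk k) (N k)]
  {Nbar : Type} [AddCommGroup Nbar] [TopologicalSpace Nbar] [DiscreteTopology Nbar]
  [∀ k, Module (Rk k) Nbar]
  {Nq : ℕ → Finset (HeightOneSpectrum (𝓞 K)) → Type} [∀ k n, AddCommGroup (Nq k n)]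
  [∀ k n, TopologicalSpace (Nq k n)] [∀ k n, DiscreteTopology (Nq k n)]
  [∀ k n, Module (Rk k) (Nq k n)] [∀ k n, Module R (Nq k n)]
  [∀ k n, IsScalarTower R (Rk k) (Nq k n)]

/-! ## §1 Admissible data exist for every Selmer class with a global lift -/

/-- **Every global lift of an `𝓕(n)`-Selmer class admits local defects supported on a finite set.**  For `ã ∈ H¹(K, T^{(t+1)})`
with `red ã ∈ H¹_{𝓕(n)}(K, T^{(i)})` (`i ≤ t+1`, `n ⊆ 𝓛^{(t+1)}`, `p ∤ #𝓞_K^×`) and a presentation `ι` of `ker red`: there are a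
finite `Σ` and `m_v ∈ H¹(K_v, N_0)` with `loc_v ã − ℓ_v = ι_v m_v`, `ℓ_v ∈ 𝓕(n)_{t+1,v}`, at every place and `m_v = 0` off `Σ`
(Howard's local lifts `β'_v`/`α'_v`: `DVRSettingLevelConditionsCocartesianProofs`; the finite exceptional set of `ã`:
`DVRSettingLevelConditionsCartesianProofs` §4; the snake step: `exists_localDefects_of_forall_exists_redLELoc_eq`).
[cite: Howard2004HeegnerKolyvagin, §1.4 (arXiv:1202.6340 p. 8 L22–30, L66–80)] -/
theorem exists_localDefects_of_redLEH1_mem (S : DVRSetting p K R N Rk Nbar Nq) (hy : S.SatisfiesH)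
    (hu : ¬ p ∣ Nat.card (𝓞 K)ˣ) {i t : ℕ} (hit : i ≤ t + 1) {n : Finset (HeightOneSpectrum (𝓞 K))}
    (hn : ↑n ⊆ S.levelPrimes (t + 1)) (ι : N 0 →ₗ[R] N (t + 1))
    (hιg : ∀ (g : absoluteGaloisGroup K) (x : N 0), ι (S.T.ρ 0 g x) = S.T.ρ (t + 1) g (ι x))
    (hιinj : Function.Injective ι) (hιex : ∀ y : N (t + 1), S.T.redLE hit y = 0 ↔ ∃ x, ι x = y)
    (ã : galoisCohomology (S.T.ρ (t + 1)) 1) (hã : S.redLEH1 hit ã ∈ (((S.t i).atLevel S.jbar n).cond).selmerGroup) :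
    ∃ (Sfin : Finset (Place K)) (m : ∀ v : Place K, galoisCohomology ((S.T.ρ 0).toLocal v) 1),
      (∀ v, ∃ ℓ ∈ ((S.t (t + 1)).atLevel S.jbar n).cond v,
        galoisCohomology.localization (S.T.ρ (t + 1)) v 1 ã - ℓ =
          ContinuousRep.cohomologyMap ((S.T.ρ 0).toLocal v) ((S.T.ρ (t + 1)).toLocal v) ι.toAddMonoidHom
            continuous_of_discreteTopology (fun _ x => hιg _ x) 1 (m v)) ∧
      ∀ v ∉ Sfin, m v = 0 := by
  obtain ⟨Sfin, -, -, hout⟩ := S.exists_finset_forall_localization_mem_atLevel_cond (t + 1) n ã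
  obtain ⟨m, hm, hmS⟩ := S.exists_localDefects_of_forall_exists_redLELoc_eq hit n ι hιg hιinj hιex ã Sfin
    (fun v _ => S.exists_mem_atLevel_cond_redLELoc_eq_redLELoc_localization hy hu hit hn hã v) hout
  exact ⟨Sfin, m, hm, hmS⟩

/-! ## §2 The pairing -/

/-- **Howard's / Flach's pairing of the level sequence, defined on classes (C451-CL Q2).**  On a `DVRSetting` with H.0–H.5,
`p ∤ #𝓞_K^×`, levels `i ≤ t+1`, `n ⊆ 𝓛^{(t+1)}`, a presentation `ι : N_0 ↪ T^{(t+1)}` of `ker red_{t+1→i}` whose local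
`H¹`-maps are cartesian for `𝓕(n)` (`hιF`), a family `inv` of local invariants at a level `n₀` killing `N_0` satisfying the
reciprocity law, and GLOBAL LIFTS of the Selmer classes (`hlift`, = `Ш²(K, N_0) = 0` under H.0–H.5): there is a bi-additive
`P : H¹_{𝓕(n)}(K, T^{(i)}) → H¹_{𝓕(n)_0^*}(K, N_0^∨(1)) → ℤ/n₀` whose value on `(a, y)` is `Σ_{v ∈ Σ} inv_v(m_v ∪ loc_v y)` for EVERY
lift `ã` of `a`, EVERY family `m` of local defects of `ã` and EVERY finite `Σ` supporting `m` («independent of all choices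
made»: `sum_localTatePairingZMod_defects_eq`; additive in `a` by `localDefects_add`, in `y` termwise).
[cite: Howard2004HeegnerKolyvagin, §1.4 and Prop. 1.4.1 (arXiv:1202.6340 p. 8 L38–98)] [cite: Flach1990, the generalised Cassels–Tate pairing]
[cite: MilneADT2006, Ch. I §6 Prop. 6.9 (the recipe) and I Thm. 4.10] -/
theorem exists_towerCasselsTatePairing (S : DVRSetting p K R N Rk Nbar Nq) [Finite (N 0)] (hy : S.SatisfiesH)
    (hu : ¬ p ∣ Nat.card (𝓞 K)ˣ) {i t : ℕ} (hit : i ≤ t + 1) {n : Finset (HeightOneSpectrum (𝓞 K))}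
    (hn : ↑n ⊆ S.levelPrimes (t + 1)) (ι : N 0 →ₗ[R] N (t + 1))
    (hιg : ∀ (g : absoluteGaloisGroup K) (x : N 0), ι (S.T.ρ 0 g x) = S.T.ρ (t + 1) g (ι x))
    (hιinj : Function.Injective ι) (hιex : ∀ y : N (t + 1), S.T.redLE hit y = 0 ↔ ∃ x, ι x = y)
    (hιF : ∀ (v : Place K) (m : galoisCohomology ((S.T.ρ 0).toLocal v) 1),
      ContinuousRep.cohomologyMap ((S.T.ρ 0).toLocal v) ((S.T.ρ (t + 1)).toLocal v) ι.toAddMonoidHom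
          continuous_of_discreteTopology (fun _ x => hιg _ x) 1 m ∈ ((S.t (t + 1)).atLevel S.jbar n).cond v ↔
        m ∈ ((S.t 0).atLevel S.jbar n).cond v)
    {n₀ : ℕ} [NeZero n₀] (hM : ∀ x : N 0, n₀ • x = 0) (inv : LocalInvariants K n₀) (hPT : inv.SumLocalTermEqZero)
    (hlift : ∀ a ∈ (((S.t i).atLevel S.jbar n).cond).selmerGroup,
      ∃ ã : galoisCohomology (S.T.ρ (t + 1)) 1, S.redLEH1 hit ã = a) :
    ∃ P : ↥(((S.t i).atLevel S.jbar n).cond).selmerGroup →+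
        ↥(inv.dualSelmerStructure (S.T.ρ 0) ((S.t 0).atLevel S.jbar n).cond).selmerGroup →+ ZMod n₀,
      ∀ (a : ↥(((S.t i).atLevel S.jbar n).cond).selmerGroup) (ã : galoisCohomology (S.T.ρ (t + 1)) 1)
        (_ : S.redLEH1 hit ã = a) (m : ∀ v : Place K, galoisCohomology ((S.T.ρ 0).toLocal v) 1)
        (_ : ∀ v, ∃ ℓ ∈ ((S.t (t + 1)).atLevel S.jbar n).cond v,
          galoisCohomology.localization (S.T.ρ (t + 1)) v 1 ã - ℓ =
            ContinuousRep.cohomologyMap ((S.T.ρ 0).toLocal v) ((S.T.ρ (t + 1)).toLocal v) ι.toAddMonoidHom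
              continuous_of_discreteTopology (fun _ x => hιg _ x) 1 (m v))
        (Sfin : Finset (Place K)) (_ : ∀ v ∉ Sfin, m v = 0)
        (y : ↥(inv.dualSelmerStructure (S.T.ρ 0) ((S.t 0).atLevel S.jbar n).cond).selmerGroup),
        P a y = ∑ v ∈ Sfin, localTatePairingZMod (S.T.ρ 0) n₀ v (inv v) (m v)
          (galoisCohomology.localization ((S.T.ρ 0).tateDual n₀) v 1 y) := by
  classical
  -- canonical data for every Selmer class: a lift, a finite set, defects
  have hdata : ∀ a : ↥(((S.t i).atLevel S.jbar n).cond).selmerGroup,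
      ∃ (ã : galoisCohomology (S.T.ρ (t + 1)) 1) (Sfin : Finset (Place K))
        (m : ∀ v : Place K, galoisCohomology ((S.T.ρ 0).toLocal v) 1),
        S.redLEH1 hit ã = a ∧
        (∀ v, ∃ ℓ ∈ ((S.t (t + 1)).atLevel S.jbar n).cond v,
          galoisCohomology.localization (S.T.ρ (t + 1)) v 1 ã - ℓ =
            ContinuousRep.cohomologyMap ((S.T.ρ 0).toLocal v) ((S.T.ρ (t + 1)).toLocal v) ι.toAddMonoidHom
              continuous_of_discreteTopology (fun _ x => hιg _ x) 1 (m v)) ∧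
        ∀ v ∉ Sfin, m v = 0 := fun a => by
    obtain ⟨ã, hã⟩ := hlift a.1 a.2
    obtain ⟨Sfin, m, hm, hmS⟩ := S.exists_localDefects_of_redLEH1_mem hy hu hit hn ι hιg hιinj hιex ã (hã ▸ a.2)
    exact ⟨ã, Sfin, m, hã, hm, hmS⟩
  choose lift Sf dft hlift' hdft hdftS using hdata
  -- the value functional of a datum
  let val : (∀ v : Place K, galoisCohomology ((S.T.ρ 0).toLocal v) 1) → Finset (Place K) →
      ↥(inv.dualSelmerStructure (S.T.ρ 0) ((S.t 0).atLevel S.jbar n).cond).selmerGroup →+ ZMod n₀ :=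
    fun m Sfin =>
      { toFun := fun y => ∑ v ∈ Sfin, localTatePairingZMod (S.T.ρ 0) n₀ v (inv v) (m v)
          (galoisCohomology.localization ((S.T.ρ 0).tateDual n₀) v 1 y)
        map_zero' := by simp
        map_add' := fun y y' => by
          rw [← Finset.sum_add_distrib]
          refine Finset.sum_congr rfl fun v _ => ?_
          rw [AddSubgroup.coe_add, map_add, map_add] }
  have hval : ∀ m Sfin (y : ↥(inv.dualSelmerStructure (S.T.ρ 0) ((S.t 0).atLevel S.jbar n).cond).selmerGroup),
      val m Sfin y = ∑ v ∈ Sfin, localTatePairingZMod (S.T.ρ 0) n₀ v (inv v) (m v)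
        (galoisCohomology.localization ((S.T.ρ 0).tateDual n₀) v 1 y) := fun _ _ _ => rfl
  -- independence of the datum (w8's LIFT-WD)
  have hindep : ∀ (a : ↥(((S.t i).atLevel S.jbar n).cond).selmerGroup) (ã : galoisCohomology (S.T.ρ (t + 1)) 1)
      (hã : S.redLEH1 hit ã = a) (m : ∀ v : Place K, galoisCohomology ((S.T.ρ 0).toLocal v) 1)
      (hm : ∀ v, ∃ ℓ ∈ ((S.t (t + 1)).atLevel S.jbar n).cond v,
        galoisCohomology.localization (S.T.ρ (t + 1)) v 1 ã - ℓ =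
          ContinuousRep.cohomologyMap ((S.T.ρ 0).toLocal v) ((S.T.ρ (t + 1)).toLocal v) ι.toAddMonoidHom
            continuous_of_discreteTopology (fun _ x => hιg _ x) 1 (m v))
      (Sfin : Finset (Place K)) (hmS : ∀ v ∉ Sfin, m v = 0)
      (y : ↥(inv.dualSelmerStructure (S.T.ρ 0) ((S.t 0).atLevel S.jbar n).cond).selmerGroup),
      val (dft a) (Sf a) y = val m Sfin y := fun a ã hã m hm Sfin hmS y => by
    rw [hval, hval]
    exact S.sum_localTatePairingZMod_defects_eq hit n ι hιg hιinj hιex hιF hM inv hPT (Sf a) Sfin (lift a) ã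
      ((hlift' a).trans hã.symm) (dft a) m (hdft a) hm (hdftS a) hmS y.2
  refine ⟨AddMonoidHom.mk' (fun a => val (dft a) (Sf a)) (fun a a' => ?_), fun a ã hã m hm Sfin hmS y => ?_⟩
  · -- additivity in `a`: the datum `(ã + ã', m + m', Σ ∪ Σ')` is admissible for `a + a'`
    ext y
    rw [AddMonoidHom.add_apply]
    have hadd := hindep (a + a') (lift a + lift a')
      (by rw [map_add, hlift', hlift']; rfl) (fun v => dft a v + dft a' v)
      (S.localDefects_add n ι hιg (lift a) (lift a') (dft a) (dft a') (hdft a) (hdft a')) (Sf a ∪ Sf a')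
      (fun v hv => by
        rw [hdftS a v (fun h => hv (Finset.mem_union_left _ h)),
          hdftS a' v (fun h => hv (Finset.mem_union_right _ h)), add_zero]) y
    rw [hadd, hval, hval, hval,
      ← S.sum_localTatePairingZMod_defects_eq_of_subset inv (Finset.subset_union_left (s₂ := Sf a')) (dft a) (hdftS a) y,
      ← S.sum_localTatePairingZMod_defects_eq_of_subset inv (Finset.subset_union_right (s₁ := Sf a)) (dft a') (hdftS a') y,
      ← Finset.sum_add_distrib]
    refine Finset.sum_congr rfl fun v _ => ?_
    rw [map_add, AddMonoidHom.add_apply]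
  · -- the value on ANY admissible datum
    change val (dft a) (Sf a) y = _
    rw [hindep a ã hã m hm Sfin hmS y, hval]

/-- **The easy half of the left kernel: `P (red z) = 0` for `z ∈ H¹_{𝓕(n)}(K, T^{(t+1)})`** — take the lift `ã := z`, whose
localisations are themselves `𝓕(n)`-Selmer, so all defects may be taken `0`.
[cite: Howard2004HeegnerKolyvagin, Prop. 1.4.1 (arXiv:1202.6340 p. 8 L94–98: «the kernel on the left is the image of H¹_𝓕(K, T/𝔪^{s+t}T)»)] -/
theorem towerCasselsTatePairing_eq_zero_of_exists_selmer_lift (S : DVRSetting p K R N Rk Nbar Nq) [Finite (N 0)]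
    {i t : ℕ} (hit : i ≤ t + 1) {n : Finset (HeightOneSpectrum (𝓞 K))} (ι : N 0 →ₗ[R] N (t + 1))
    (hιg : ∀ (g : absoluteGaloisGroup K) (x : N 0), ι (S.T.ρ 0 g x) = S.T.ρ (t + 1) g (ι x))
    {n₀ : ℕ} [NeZero n₀] (inv : LocalInvariants K n₀)
    (P : ↥(((S.t i).atLevel S.jbar n).cond).selmerGroup →+
        ↥(inv.dualSelmerStructure (S.T.ρ 0) ((S.t 0).atLevel S.jbar n).cond).selmerGroup →+ ZMod n₀)
    (hP : ∀ (a : ↥(((S.t i).atLevel S.jbar n).cond).selmerGroup) (ã : galoisCohomology (S.T.ρ (t + 1)) 1)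
        (_ : S.redLEH1 hit ã = a) (m : ∀ v : Place K, galoisCohomology ((S.T.ρ 0).toLocal v) 1)
        (_ : ∀ v, ∃ ℓ ∈ ((S.t (t + 1)).atLevel S.jbar n).cond v,
          galoisCohomology.localization (S.T.ρ (t + 1)) v 1 ã - ℓ =
            ContinuousRep.cohomologyMap ((S.T.ρ 0).toLocal v) ((S.T.ρ (t + 1)).toLocal v) ι.toAddMonoidHom
              continuous_of_discreteTopology (fun _ x => hιg _ x) 1 (m v))
        (Sfin : Finset (Place K)) (_ : ∀ v ∉ Sfin, m v = 0)
        (y : ↥(inv.dualSelmerStructure (S.T.ρ 0) ((S.t 0).atLevel S.jbar n).cond).selmerGroup),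
        P a y = ∑ v ∈ Sfin, localTatePairingZMod (S.T.ρ 0) n₀ v (inv v) (m v)
          (galoisCohomology.localization ((S.T.ρ 0).tateDual n₀) v 1 y))
    (a : ↥(((S.t i).atLevel S.jbar n).cond).selmerGroup) {z : galoisCohomology (S.T.ρ (t + 1)) 1}
    (hz : z ∈ (((S.t (t + 1)).atLevel S.jbar n).cond).selmerGroup) (hza : S.redLEH1 hit z = a)
    (y : ↥(inv.dualSelmerStructure (S.T.ρ 0) ((S.t 0).atLevel S.jbar n).cond).selmerGroup) :
    P a y = 0 := by
  have h := hP a z hza (fun _ => 0)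
    (fun v => ⟨galoisCohomology.localization (S.T.ρ (t + 1)) v 1 z,
      (SelmerStructure.mem_selmerGroup_iff _ _).1 hz v, by rw [sub_self]; exact (map_zero _).symm⟩) ∅
    (fun _ _ => rfl) y
  rw [h, Finset.sum_empty]

/-! ## §3 The LEFT kernel (C451-CL Q3): `P(a, ·) = 0 ↔ a ∈ red(H¹_{𝓕(n)}(K, T^{(t+1)}))` -/

/-- **Howard Prop. 1.4.1, the kernel on the left, CLASS-LEVEL**: for the pairing `P` of `exists_towerCasselsTatePairing` (any `P`
with its value clause `hP`), an `𝓕(n)`-Selmer class `a` of `T^{(i)}` pairs to zero with all of `H¹_{𝓕(n)_0^*}(K, N_0^∨(1))` iff it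
is the reduction of an `𝓕(n)`-Selmer class of `T^{(t+1)}` — «the kernel on the left is the image of
`H¹_𝓕(K, T/𝔪^{s+t}T) → H¹_𝓕(K, T/𝔪^sT)`».  `⟸`: lift by the Selmer class itself, defects `0`.  `⟹`: with a global lift `ã`
(`hlift`) and its defects on a finite `Σ ⊇ Σ(𝓕) ∪ n`, the vanishing of `Σ_{v ∈ Σ} inv_v(m_v ∪ y_v)` for all dual-Selmer `y` is
x10b-p1-w8's Poitou–Tate criterion `exists_selmer_redLEH1_eq_iff_forall_sum_localTatePairingZMod_eq_zero` (Howard Thm. 1.1.11,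
`SelmerComplement`); its side conditions: `𝓕(n)_0` unramified off `Σ` (`isUnramifiedOutside_atLevel_cond_of_subset`), `N_0`
unramified and `n₀` invertible off `Σ(𝓕)` (`hn0S`, e.g. `n₀ = p^a`: `not_mem_and_isUnramifiedAt_of_not_mem_Sigma`).
[cite: Howard2004HeegnerKolyvagin, Prop. 1.4.1 and Thm. 1.1.11 (arXiv:1202.6340 p. 8 L83–98, p. 6)] [cite: Flach1990, proof of Thm. 1 (the kernels)]
[cite: MilneADT2006, I Thm. 4.10] -/
theorem forall_towerCasselsTatePairing_eq_zero_iff (S : DVRSetting p K R N Rk Nbar Nq) [Finite (N 0)] (hy : S.SatisfiesH)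
    (hu : ¬ p ∣ Nat.card (𝓞 K)ˣ) {i t : ℕ} (hit : i ≤ t + 1) {n : Finset (HeightOneSpectrum (𝓞 K))}
    (hn : ↑n ⊆ S.levelPrimes (t + 1)) (ι : N 0 →ₗ[R] N (t + 1))
    (hιg : ∀ (g : absoluteGaloisGroup K) (x : N 0), ι (S.T.ρ 0 g x) = S.T.ρ (t + 1) g (ι x))
    (hιinj : Function.Injective ι) (hιex : ∀ y : N (t + 1), S.T.redLE hit y = 0 ↔ ∃ x, ι x = y)
    (hιF : ∀ (v : Place K) (m : galoisCohomology ((S.T.ρ 0).toLocal v) 1),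
      ContinuousRep.cohomologyMap ((S.T.ρ 0).toLocal v) ((S.T.ρ (t + 1)).toLocal v) ι.toAddMonoidHom
          continuous_of_discreteTopology (fun _ x => hιg _ x) 1 m ∈ ((S.t (t + 1)).atLevel S.jbar n).cond v ↔
        m ∈ ((S.t 0).atLevel S.jbar n).cond v)
    {n₀ : ℕ} [NeZero n₀] (hM : ∀ x : N 0, n₀ • x = 0) (inv : LocalInvariants K n₀) (hSC : inv.SelmerComplement)
    (hPT : inv.SumLocalTermEqZero)
    (hn0S : ∀ v : HeightOneSpectrum (𝓞 K), (Sum.inr v : Place K) ∉ S.Sigma →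
      ((n₀ : ℕ) : 𝓞 K) ∉ v.asIdeal ∧ GaloisRep.IsUnramifiedAt v (S.T.ρ 0))
    (hlift : ∀ a ∈ (((S.t i).atLevel S.jbar n).cond).selmerGroup,
      ∃ ã : galoisCohomology (S.T.ρ (t + 1)) 1, S.redLEH1 hit ã = a)
    (P : ↥(((S.t i).atLevel S.jbar n).cond).selmerGroup →+
        ↥(inv.dualSelmerStructure (S.T.ρ 0) ((S.t 0).atLevel S.jbar n).cond).selmerGroup →+ ZMod n₀)
    (hP : ∀ (a : ↥(((S.t i).atLevel S.jbar n).cond).selmerGroup) (ã : galoisCohomology (S.T.ρ (t + 1)) 1)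
        (_ : S.redLEH1 hit ã = a) (m : ∀ v : Place K, galoisCohomology ((S.T.ρ 0).toLocal v) 1)
        (_ : ∀ v, ∃ ℓ ∈ ((S.t (t + 1)).atLevel S.jbar n).cond v,
          galoisCohomology.localization (S.T.ρ (t + 1)) v 1 ã - ℓ =
            ContinuousRep.cohomologyMap ((S.T.ρ 0).toLocal v) ((S.T.ρ (t + 1)).toLocal v) ι.toAddMonoidHom
              continuous_of_discreteTopology (fun _ x => hιg _ x) 1 (m v))
        (Sfin : Finset (Place K)) (_ : ∀ v ∉ Sfin, m v = 0)
        (y : ↥(inv.dualSelmerStructure (S.T.ρ 0) ((S.t 0).atLevel S.jbar n).cond).selmerGroup),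
        P a y = ∑ v ∈ Sfin, localTatePairingZMod (S.T.ρ 0) n₀ v (inv v) (m v)
          (galoisCohomology.localization ((S.T.ρ 0).tateDual n₀) v 1 y))
    (a : ↥(((S.t i).atLevel S.jbar n).cond).selmerGroup) :
    (∀ y, P a y = 0) ↔
      ∃ z ∈ (((S.t (t + 1)).atLevel S.jbar n).cond).selmerGroup, S.redLEH1 hit z = a := by
  classical
  constructor
  · intro h0
    obtain ⟨ã, hã⟩ := hlift a.1 a.2
    obtain ⟨Sfin, m, hm, hmS⟩ := S.exists_localDefects_of_redLEH1_mem hy hu hit hn ι hιg hιinj hιex ã (hã ▸ a.2)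
    -- enlarge the finite set to contain `Σ(𝓕)` and the primes of `n`
    let Sfin' : Finset (Place K) := Sfin ∪ ((S.t (t + 1)).Sigma ∪ n.image Sum.inr)
    have hmS' : ∀ v ∉ Sfin', m v = 0 := fun v hv => hmS v fun h => hv (Finset.mem_union_left _ h)
    have hSig : (S.t 0).Sigma ⊆ Sfin' := by
      rw [hy.Sigma_eq 0, ← hy.Sigma_eq (t + 1)]
      exact fun v hv => Finset.mem_union_right _ (Finset.mem_union_left _ hv)
    have hnS : ∀ w ∈ n, (Sum.inr w : Place K) ∈ Sfin' := fun w hw =>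
      Finset.mem_union_right _ (Finset.mem_union_right _ (Finset.mem_image_of_mem _ hw))
    have hFS := S.isUnramifiedOutside_atLevel_cond_of_subset 0 n hSig hnS
    have hSp : ∀ v : HeightOneSpectrum (𝓞 K), (Sum.inr v : Place K) ∉ Sfin' →
        ((n₀ : ℕ) : 𝓞 K) ∉ v.asIdeal ∧ GaloisRep.IsUnramifiedAt v (S.T.ρ 0) := fun v hv =>
      hn0S v fun h => hv (hSig (by rw [hy.Sigma_eq 0]; exact h))
    refine (S.exists_selmer_redLEH1_eq_iff_forall_sum_localTatePairingZMod_eq_zero hit n ι hιg hιinj hιex hιF hM inv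
      hSC hPT Sfin' hSp hFS ã hã m hm hmS').2 fun y hy' => ?_
    rw [← hP a ã hã m hm Sfin' hmS' ⟨y, hy'⟩]
    exact h0 ⟨y, hy'⟩
  · rintro ⟨z, hz, hza⟩ y
    exact S.towerCasselsTatePairing_eq_zero_of_exists_selmer_lift hit ι hιg inv P hP a hz hza y

end DVRSetting

end Literature.NumberTheory.GaloisCohomology.Howard2004

end
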